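import Summits.HodgeConjecture.HodgeConjecture.Theorems.HodgeLocusCensusPlaneSumCert
import HarnessLib

/-!
# HodgeLocusCensusZ8RankCert — generic kernel-checkable rank certificates for matrices over ℤ[ζ₈] given by row/column DATA lists (cell pub-hlocus, lead seat ivhs-1, gen 6)
HONEST FRAMING: certified instances and evidence bearing on the general Hodge conjecture; no claim.

A reusable certificate format deciding `rank N = r` for a matrix `N : Matrix (Fin m) (Fin n) K` (K a field of characteristic 0, ζ ∈ K, ζ⁴ = −1) with
`N a b = eval_ζ (f (rows[a]) (cols[b]))` for an entry function `f : RD → CD → ℤ[ζ₈]` (`PlaneSum.Z8`) on data lists `rows : List RD`, `cols : List CD` — built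
for the 266 × 266 matrices of the Fermat quartic sixfold with planes of DIFFERENT matchings (`HodgeLocusCensusQuartic*`; cf. the dense 45 × 120 format
`HodgeLocusCensusDenseCert8`). The checker WALKS the data lists structurally (`allIx`, `allIx2`); a TYPE grading `tyR`, `tyC` with the structural
vanishing `tyR rd + tyC cd ≠ tgt → f rd cd = 0` (hypothesis `hvan` of the soundness theorem, proved once per instance) lets it skip incompatible pairs,
row expressions being checked to use pivot rows of the row's own type only (`wrowOK`); rows are SPARSE combinations of the pivot rows with a positive
integer denominator, D_a · N[a,·] = Σ_{(ℓ,c) ∈ W_a} c · N[ρ_ℓ,·] (rank ≤ r); the pivot minor factors as A · B = d_AB · N[ρ,γ], A lower / B upper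
triangular and integral with positive-integer diagonal products (det ≠ 0 in characteristic 0, rank ≥ r). `Cert.valid` is ONE Boolean (`decide +kernel`
in the data files), `rank_eq_of_valid` the soundness theorem; (U) in two chunks (`validU_append`) is in `HodgeLocusCensusQuarticStack`. Nothing here is
specific to Hodge loci: the instance files supply `f`, the gradings, `hvan` and the identification of `N` with Movasati's matrix.
-/

namespace Summit.HodgeConjecture.HodgeConjecture.HodgeLocus.Census.Z8Cert

open PlaneSum

/-! ## Structural list walkers -/

/-- `allIx p i [x₀, x₁, …] = p i x₀ && p (i+1) x₁ && …`. -/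
def allIx {α : Type*} (p : ℕ → α → Bool) : ℕ → List α → Bool
  | _, [] => true
  | i, x :: xs => p i x && allIx p (i + 1) xs

/-- `allIx` is the indexed ∀ over the list (positions read with `lget`). -/
theorem allIx_get {α : Type*} (p : ℕ → α → Bool) (d : α) :
    ∀ (i : ℕ) (xs : List α), allIx p i xs = true → ∀ k < xs.length, p (i + k) (lget d xs k) = true
  | _, [], _, k, hk => absurd hk (by simp)
  | i, x :: xs, h, 0, _ => by rw [allIx, Bool.and_eq_true] at h; simpa [lget] using h.1
  | i, x :: xs, h, k + 1, hk => by
    rw [allIx, Bool.and_eq_true] at h; rw [show i + (k + 1) = i + 1 + k by omega]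
    exact allIx_get p d (i + 1) xs h.2 k (by simpa using hk)

/-- two-list walker: `allIx2 dy p i xs ys = p i x₀ y₀ && p (i+1) x₁ y₁ && …` (ys padded with `dy`). -/
def allIx2 {α β : Type*} (dy : β) (p : ℕ → α → β → Bool) : ℕ → List α → List β → Bool
  | _, [], _ => true
  | i, x :: xs, [] => p i x dy && allIx2 dy p (i + 1) xs []
  | i, x :: xs, y :: ys => p i x y && allIx2 dy p (i + 1) xs ys

/-- `allIx2` is the indexed ∀ over the first list, the second read with `lget dy`. -/
theorem allIx2_get {α β : Type*} (dy : β) (p : ℕ → α → β → Bool) (d : α) :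
    ∀ (i : ℕ) (xs : List α) (ys : List β), allIx2 dy p i xs ys = true → ∀ k < xs.length, p (i + k) (lget d xs k) (lget dy ys k) = true
  | _, [], _, _, k, hk => absurd hk (by simp)
  | i, x :: xs, [], h, 0, _ => by rw [allIx2, Bool.and_eq_true] at h; simpa [lget] using h.1
  | i, x :: xs, y :: ys, h, 0, _ => by rw [allIx2, Bool.and_eq_true] at h; simpa [lget] using h.1
  | i, x :: xs, [], h, k + 1, hk => by
    rw [allIx2, Bool.and_eq_true] at h; rw [show i + (k + 1) = i + 1 + k by omega]
    simpa [lget] using allIx2_get dy p d (i + 1) xs [] h.2 k (by simpa using hk)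
  | i, x :: xs, y :: ys, h, k + 1, hk => by
    rw [allIx2, Bool.and_eq_true] at h; rw [show i + (k + 1) = i + 1 + k by omega]
    simpa [lget] using allIx2_get dy p d (i + 1) xs ys h.2 k (by simpa using hk)

/-! ## Sparse rows over ℤ[ζ₈] -/

/-- Σ_{(ℓ, c) ∈ row} c · g ℓ. -/
def spsum (g : ℕ → Z8) : List (ℕ × Z8) → Z8
  | [] => 0
  | e :: row => e.2 * g e.1 + spsum g row

/-- the total coefficient of index ℓ in a sparse row. -/
def wcoef : List (ℕ × Z8) → ℕ → Z8
  | [], _ => 0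
  | e :: row, l => (if e.1 = l then e.2 else 0) + wcoef row l

section evals

variable {K : Type*} [Field K] (ζ : K)

/-- eval of a sparse sum. -/
theorem eval_spsum (h4 : ζ ^ 4 = -1) (g : ℕ → Z8) (row : List (ℕ × Z8)) :
    Z8.eval ζ (spsum g row) = (row.map fun e => Z8.eval ζ e.2 * Z8.eval ζ (g e.1)).sum := by
  induction row with
  | nil => simp [spsum, Z8.zero_def, Z8.eval_zero]
  | cons e row ih => rw [spsum, Z8.eval_add, Z8.eval_mul ζ h4, ih, List.map_cons, List.sum_cons]

/-- the dense sum Σ_{ℓ < r} wcoef(ℓ) · X ℓ is the sparse sum (all indices < r). -/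
theorem sum_wcoef (r : ℕ) (X : ℕ → K) (row : List (ℕ × Z8)) (hr : ∀ e ∈ row, e.1 < r) :
    ∑ l ∈ Finset.range r, Z8.eval ζ (wcoef row l) * X l = (row.map fun e => Z8.eval ζ e.2 * X e.1).sum := by
  induction row with
  | nil => simp [wcoef, Z8.zero_def, Z8.eval_zero]
  | cons e row ih =>
    have he : e.1 < r := hr e (by simp)
    have hrow : ∀ e' ∈ row, e'.1 < r := fun e' h => hr e' (by simp [h])
    have hsplit : ∀ l, Z8.eval ζ (wcoef (e :: row) l) * X l =
        (if e.1 = l then Z8.eval ζ e.2 * X l else 0) + Z8.eval ζ (wcoef row l) * X l := by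
      intro l
      rw [wcoef, Z8.eval_add, add_mul]
      split_ifs
      · rfl
      · rw [Z8.zero_def, Z8.eval_zero, zero_mul]
    simp only [hsplit, Finset.sum_add_distrib, ih hrow, List.map_cons, List.sum_cons]
    rw [Finset.sum_ite_eq, if_pos (Finset.mem_range.mpr he)]

/-- a nonzero total coefficient comes from a listed entry. -/
theorem exists_of_wcoef_ne_zero (row : List (ℕ × Z8)) (l : ℕ) (h : wcoef row l ≠ 0) : ∃ e ∈ row, e.1 = l := by
  induction row with
  | nil => exact absurd rfl h
  | cons e row ih =>
    by_cases hel : e.1 = l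
    · exact ⟨e, by simp, hel⟩
    · rw [wcoef, if_neg hel] at h
      have h' : wcoef row l ≠ 0 := by
        intro hz
        apply h
        rw [hz]
        rfl
      obtain ⟨e', he', hl⟩ := ih h'
      exact ⟨e', by simp [he'], hl⟩

end evals

/-! ## Certificates -/

/-- x = 0 in ℤ[ζ₈] (Boolean). -/
def zIsZero (x : Z8) : Bool := decide (x = 0)

/-- a rank certificate for the matrix (f rows[a] cols[b])_{a<m, b<n}: the rank `r`; the pivot rows `rho` (positions in `rows`) with their data
`rhoD`, the pivot columns `gam` / `gamD`, in elimination order; per row a the denominator D_a and the sparse expression W_a of D_a · row a in the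
pivot rows; the integral triangular factors `A` (r × r lower), `B` (r × r upper) with A · B = dAB · (pivot minor), and the norm cofactors `w` of B's
diagonal. -/
structure Cert (RD CD : Type*) where
  r : ℕ
  rho : List ℕ
  rhoD : List RD
  gam : List ℕ
  gamD : List CD
  W : List (ℤ × List (ℕ × Z8))
  A : List (List Z8)
  B : List (List Z8)
  dAB : ℤ
  w : List Z8

namespace Cert

variable {RD CD : Type*} [Inhabited RD] [Inhabited CD] [DecidableEq RD] [DecidableEq CD] (Ψ : Cert RD CD)

/-- ρ_ℓ. -/
def rhoN (l : ℕ) : ℕ := lget 0 Ψ.rho l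
/-- γ_ℓ. -/
def gamN (l : ℕ) : ℕ := lget 0 Ψ.gam l
/-- the data of pivot row ℓ … -/
def rhoDat (l : ℕ) : RD := lget default Ψ.rhoD l
/-- … and of pivot column ℓ. -/
def gamDat (l : ℕ) : CD := lget default Ψ.gamD l
/-- (D_a, W_a). -/
def Wrow (a : ℕ) : ℤ × List (ℕ × Z8) := lget (1, []) Ψ.W a
/-- A[h, ℓ]. -/
def Az (h l : ℕ) : Z8 := lget 0 (lget [] Ψ.A h) l
/-- B[ℓ, g]. -/
def Bz (l g : ℕ) : Z8 := lget 0 (lget [] Ψ.B l) g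
/-- w_ℓ. -/
def wz (l : ℕ) : Z8 := lget 0 Ψ.w l

/-- the entries of a sparse row point at pivots of the row's own type. -/
def wrowOK (tyR : RD → ℕ) (rd : RD) (row : List (ℕ × Z8)) : Bool :=
  row.all fun e => decide (e.1 < Ψ.r) && (tyR (Ψ.rhoDat e.1) == tyR rd)

/-- (U) the check of one row (data rd, denominator D_a > 0, expression W_a): W_a points at pivots of rd's type and, for every column of
compatible type, Σ_{(ℓ,c) ∈ W_a} c · f(ρ-data ℓ, cd) = D_a · f(rd, cd). -/
def pU (f : RD → CD → Z8) (tyR : RD → ℕ) (tyC : CD → ℕ) (tgt : ℕ) (cols : List CD) : ℕ → RD → ℤ × List (ℕ × Z8) → Bool :=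
  fun _ rd dw => decide (0 < dw.1) && Ψ.wrowOK tyR rd dw.2 &&
    allIx (fun _ cd => decide (tyR rd + tyC cd ≠ tgt) || decide (spsum (fun l => f (Ψ.rhoDat l) cd) dw.2 = Z8.smul dw.1 (f rd cd))) 0 cols
/-- (U) for all rows (walked in parallel with `W`; it depends on Ψ only through `r`, `rhoD` and `W`, so it can be checked in chunks, `validU_append`). -/
def validU (f : RD → CD → Z8) (tyR : RD → ℕ) (tyC : CD → ℕ) (tgt : ℕ) (rows : List RD) (cols : List CD) : Bool :=
  allIx2 ((1 : ℤ), ([] : List (ℕ × Z8))) (Ψ.pU f tyR tyC tgt cols) 0 rows Ψ.W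
/-- (R) the pivot data are the data at the pivot positions, which are in range. -/
def validR (rows : List RD) (cols : List CD) (m n : ℕ) : Bool :=
  Z8.allLT Ψ.r fun l => decide (Ψ.rhoN l < m) && decide (Ψ.rhoDat l = lget default rows (Ψ.rhoN l)) &&
    decide (Ψ.gamN l < n) && decide (Ψ.gamDat l = lget default cols (Ψ.gamN l))
/-- (L) the factors re-multiply to dAB · (pivot minor). -/
def validL (f : RD → CD → Z8) : Bool :=
  Z8.allLT Ψ.r fun h => Z8.allLT Ψ.r fun g =>
    decide (Z8.rsum Ψ.r (fun l => Ψ.Az h l * Ψ.Bz l g) = Z8.smul Ψ.dAB (f (Ψ.rhoDat h) (Ψ.gamDat g)))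
/-- (T) A is lower and B upper triangular. -/
def validT : Bool :=
  Z8.allLT Ψ.r fun h => Z8.allLT Ψ.r fun l => (!decide (h < l) || zIsZero (Ψ.Az h l)) && (!decide (l < h) || zIsZero (Ψ.Bz h l))
/-- (P) pivots: A_ℓℓ and B_ℓℓ · w_ℓ are positive integers; dAB > 0. -/
def validP : Bool :=
  decide (0 < Ψ.dAB) && Z8.allLT Ψ.r fun l => (Ψ.Az l l).isPosConst && (Ψ.Bz l l * Ψ.wz l).isPosConst
/-- the whole certificate check for the m × n matrix (f rows[a] cols[b]). -/
def valid (f : RD → CD → Z8) (tyR : RD → ℕ) (tyC : CD → ℕ) (tgt : ℕ) (rows : List RD) (cols : List CD) (m n : ℕ) : Bool :=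
  Ψ.validU f tyR tyC tgt rows cols && Ψ.validR rows cols m n && Ψ.validL f && Ψ.validT && Ψ.validP

variable {Ψ} {f : RD → CD → Z8} {tyR : RD → ℕ} {tyC : CD → ℕ} {tgt : ℕ} {rows : List RD} {cols : List CD} {m n : ℕ}

/-- (U) unfolded at a pair (a, b). -/
theorem U_row (h : Ψ.valid f tyR tyC tgt rows cols m n = true) {a : ℕ} (ha : a < rows.length) :
    0 < (Ψ.Wrow a).1 ∧ Ψ.wrowOK tyR (lget default rows a) (Ψ.Wrow a).2 = true ∧
      ∀ b < cols.length, tyR (lget default rows a) + tyC (lget default cols b) ≠ tgt ∨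
        spsum (fun l => f (Ψ.rhoDat l) (lget default cols b)) (Ψ.Wrow a).2 = Z8.smul (Ψ.Wrow a).1 (f (lget default rows a) (lget default cols b)) := by
  have h1 : Ψ.validU f tyR tyC tgt rows cols = true := by
    simp only [valid, Bool.and_eq_true] at h
    exact h.1.1.1.1
  unfold validU pU at h1
  have h2 := allIx2_get _ _ default 0 rows Ψ.W h1 a ha
  simp only [Bool.and_eq_true, decide_eq_true_eq] at h2
  obtain ⟨⟨hD, hOK⟩, hC⟩ := h2
  refine ⟨hD, hOK, fun b hb => ?_⟩
  have h3 := allIx_get _ default 0 cols hC b hb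
  simp only [Bool.or_eq_true, decide_eq_true_eq] at h3
  exact h3

/-- (R) unfolded. -/
theorem R_eq (h : Ψ.valid f tyR tyC tgt rows cols m n = true) {l : ℕ} (hl : l < Ψ.r) :
    Ψ.rhoN l < m ∧ Ψ.rhoDat l = lget default rows (Ψ.rhoN l) ∧ Ψ.gamN l < n ∧ Ψ.gamDat l = lget default cols (Ψ.gamN l) := by
  have h1 : Ψ.validR rows cols m n = true := by
    simp only [valid, Bool.and_eq_true] at h
    exact h.1.1.1.2
  unfold validR at h1
  rw [Z8.allLT_iff] at h1
  have h2 := h1 l hl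
  simp only [Bool.and_eq_true, decide_eq_true_eq] at h2
  exact ⟨h2.1.1.1, h2.1.1.2, h2.1.2, h2.2⟩

/-- (L) unfolded. -/
theorem L_eq (h : Ψ.valid f tyR tyC tgt rows cols m n = true) {h' g : ℕ} (hh : h' < Ψ.r) (hg : g < Ψ.r) :
    Z8.rsum Ψ.r (fun l => Ψ.Az h' l * Ψ.Bz l g) = Z8.smul Ψ.dAB (f (Ψ.rhoDat h') (Ψ.gamDat g)) := by
  have h1 : Ψ.validL f = true := by
    simp only [valid, Bool.and_eq_true] at h
    exact h.1.1.2
  unfold validL at h1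
  rw [Z8.allLT_iff] at h1
  have h2 := h1 h' hh
  rw [Z8.allLT_iff] at h2
  exact of_decide_eq_true (h2 g hg)

/-- (T) A above the diagonal vanishes … -/
theorem A_upper_zero (h : Ψ.valid f tyR tyC tgt rows cols m n = true) {h' l : ℕ} (hh : h' < Ψ.r) (hl : l < Ψ.r) (hlt : h' < l) :
    Ψ.Az h' l = 0 := by
  have h1 : Ψ.validT = true := by
    simp only [valid, Bool.and_eq_true] at h
    exact h.1.2
  unfold validT at h1
  rw [Z8.allLT_iff] at h1
  have h2 := h1 h' hh
  rw [Z8.allLT_iff] at h2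
  have h3 := h2 l hl
  simp only [Bool.and_eq_true, Bool.or_eq_true, Bool.not_eq_true', decide_eq_false_iff_not, zIsZero, decide_eq_true_eq] at h3
  rcases h3.1 with h4 | h4
  · exact absurd hlt h4
  · exact h4

/-- … and B below the diagonal. -/
theorem B_lower_zero (h : Ψ.valid f tyR tyC tgt rows cols m n = true) {h' l : ℕ} (hh : h' < Ψ.r) (hl : l < Ψ.r) (hlt : l < h') :
    Ψ.Bz h' l = 0 := by
  have h1 : Ψ.validT = true := by
    simp only [valid, Bool.and_eq_true] at h
    exact h.1.2
  unfold validT at h1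
  rw [Z8.allLT_iff] at h1
  have h2 := h1 h' hh
  rw [Z8.allLT_iff] at h2
  have h3 := h2 l hl
  simp only [Bool.and_eq_true, Bool.or_eq_true, Bool.not_eq_true', decide_eq_false_iff_not, zIsZero, decide_eq_true_eq] at h3
  rcases h3.2 with h4 | h4
  · exact absurd hlt h4
  · exact h4

/-- (P) unfolded. -/
theorem pivots (h : Ψ.valid f tyR tyC tgt rows cols m n = true) :
    0 < Ψ.dAB ∧ ∀ l < Ψ.r, (Ψ.Az l l).isPosConst = true ∧ (Ψ.Bz l l * Ψ.wz l).isPosConst = true := by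
  have h1 : Ψ.validP = true := by
    simp only [valid, Bool.and_eq_true] at h
    exact h.2
  unfold validP at h1
  rw [Bool.and_eq_true, Z8.allLT_iff] at h1
  refine ⟨of_decide_eq_true h1.1, fun l hl => ?_⟩
  have h2 := h1.2 l hl
  rw [Bool.and_eq_true] at h2
  exact h2

omit [Inhabited CD] [DecidableEq RD] [DecidableEq CD] in
/-- entries of a type-consistent sparse row: index < r and same type as the row. -/
theorem wrowOK_mem {rd : RD} {row : List (ℕ × Z8)} (h : Ψ.wrowOK tyR rd row = true) {e : ℕ × Z8} (he : e ∈ row) :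
    e.1 < Ψ.r ∧ tyR (Ψ.rhoDat e.1) = tyR rd := by
  unfold wrowOK at h
  rw [List.all_eq_true] at h
  have h1 := h e he
  simp only [Bool.and_eq_true, decide_eq_true_eq, beq_iff_eq] at h1
  exact h1

end Cert

/-! ## Soundness -/

section sound

variable {K : Type*} [Field K] [CharZero K] (ζ : K)
variable {RD CD : Type*} [Inhabited RD] [Inhabited CD] [DecidableEq RD] [DecidableEq CD]
variable {f : RD → CD → Z8} {tyR : RD → ℕ} {tyC : CD → ℕ} {tgt : ℕ} {rows : List RD} {cols : List CD} {m n : ℕ} {Ψ : Cert RD CD}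

/-- UPPER BOUND: rank N ≤ r (every row is a combination of the pivot rows). -/
theorem rank_le_of_valid (h4 : ζ ^ 4 = -1) (hvan : ∀ rd cd, tyR rd + tyC cd ≠ tgt → f rd cd = 0)
    (hm : rows.length = m) (hn : cols.length = n) (hV : Ψ.valid f tyR tyC tgt rows cols m n = true)
    (N : Matrix (Fin m) (Fin n) K) (hN : ∀ a b, N a b = Z8.eval ζ (f (lget default rows a.1) (lget default cols b.1))) :
    N.rank ≤ Ψ.r := by
  let ρf : Fin Ψ.r → Fin m := fun l => ⟨Ψ.rhoN l.1, (Cert.R_eq hV l.2).1⟩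
  let Wm : Matrix (Fin m) (Fin Ψ.r) K := fun a l => Z8.eval ζ (wcoef (Ψ.Wrow a.1).2 l.1) / ((Ψ.Wrow a.1).1 : K)
  have hfac : N = Wm * N.submatrix ρf id := by
    ext a b
    obtain ⟨hD, hOK, hC⟩ := Cert.U_row hV (show a.1 < rows.length by omega)
    have hDK : ((Ψ.Wrow a.1).1 : K) ≠ 0 := by exact_mod_cast hD.ne'
    -- N[ρ_ℓ, b] in terms of the pivot data
    have hpiv : ∀ l : Fin Ψ.r, N (ρf l) b = Z8.eval ζ (f (Ψ.rhoDat l.1) (lget default cols b.1)) := by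
      intro l
      rw [hN, (Cert.R_eq hV l.2).2.1]
    have hsum : ∑ l : Fin Ψ.r, Wm a l * (N.submatrix ρf id) l b =
        (∑ l ∈ Finset.range Ψ.r, Z8.eval ζ (wcoef (Ψ.Wrow a.1).2 l) * Z8.eval ζ (f (Ψ.rhoDat l) (lget default cols b.1))) /
          ((Ψ.Wrow a.1).1 : K) := by
      rw [Finset.sum_div, Finset.sum_range]
      refine Finset.sum_congr rfl fun l _ => ?_
      rw [Matrix.submatrix_apply, id, hpiv l]
      show Z8.eval ζ (wcoef (Ψ.Wrow a.1).2 l.1) / ((Ψ.Wrow a.1).1 : K) * _ = _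
      ring
    rw [Matrix.mul_apply, hsum, sum_wcoef ζ Ψ.r _ _ (fun e he => (Cert.wrowOK_mem hOK he).1)]
    rcases hC b.1 (by omega) with hty | hU
    · -- incompatible pair: both sides vanish
      have hzero : ∀ e ∈ (Ψ.Wrow a.1).2, Z8.eval ζ e.2 * Z8.eval ζ (f (Ψ.rhoDat e.1) (lget default cols b.1)) = 0 := by
        intro e he
        have hte := (Cert.wrowOK_mem hOK he).2
        rw [hvan _ _ (by rw [hte]; exact hty), Z8.zero_def, Z8.eval_zero, mul_zero]
      rw [hN, hvan _ _ hty, Z8.zero_def, Z8.eval_zero, List.sum_eq_zero (fun x hx => ?_), zero_div]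
      obtain ⟨e, he, rfl⟩ := List.mem_map.mp hx
      exact hzero e he
    · have hev := congrArg (Z8.eval ζ) hU
      rw [eval_spsum ζ h4, Z8.eval_smul] at hev
      rw [hev, hN, mul_div_cancel_left₀ _ hDK]
  rw [hfac]
  exact (Matrix.rank_mul_le_right _ _).trans ((Matrix.rank_le_card_height _).trans (by simp))

/-- LOWER BOUND: r ≤ rank N (the pivot minor is lower × upper triangular with nonzero diagonals, up to the positive integer dAB). -/
theorem le_rank_of_valid (h4 : ζ ^ 4 = -1) (hV : Ψ.valid f tyR tyC tgt rows cols m n = true)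
    (N : Matrix (Fin m) (Fin n) K) (hN : ∀ a b, N a b = Z8.eval ζ (f (lget default rows a.1) (lget default cols b.1))) :
    Ψ.r ≤ N.rank := by
  classical
  obtain ⟨hdAB, hpiv⟩ := Cert.pivots hV
  have hdK : (Ψ.dAB : K) ≠ 0 := by exact_mod_cast hdAB.ne'
  let ρf : Fin Ψ.r → Fin m := fun l => ⟨Ψ.rhoN l.1, (Cert.R_eq hV l.2).1⟩
  let γf : Fin Ψ.r → Fin n := fun l => ⟨Ψ.gamN l.1, (Cert.R_eq hV l.2).2.2.1⟩
  let Am : Matrix (Fin Ψ.r) (Fin Ψ.r) K := fun h l => Z8.eval ζ (Ψ.Az h.1 l.1) / (Ψ.dAB : K)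
  let Bm : Matrix (Fin Ψ.r) (Fin Ψ.r) K := fun l g => Z8.eval ζ (Ψ.Bz l.1 g.1)
  have hS : N.submatrix ρf γf = Am * Bm := by
    ext h g
    rw [Matrix.mul_apply, Matrix.submatrix_apply, hN, ← (Cert.R_eq hV h.2).2.1, ← (Cert.R_eq hV g.2).2.2.2]
    have hl := congrArg (Z8.eval ζ) (Cert.L_eq hV h.2 g.2)
    rw [Z8.eval_rsum, Finset.sum_range, Z8.eval_smul] at hl
    have hterm : ∀ l : Fin Ψ.r, Am h l * Bm l g = Z8.eval ζ (Ψ.Az h.1 l.1 * Ψ.Bz l.1 g.1) / (Ψ.dAB : K) := by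
      intro l
      rw [Z8.eval_mul ζ h4]
      ring
    simp only [hterm]
    rw [← Finset.sum_div, hl, mul_div_cancel_left₀ _ hdK]
  have hAt : Am.BlockTriangular OrderDual.toDual := by
    intro h l hlt
    have hlt' : h < l := OrderDual.toDual_lt_toDual.mp hlt
    show Z8.eval ζ (Ψ.Az h.1 l.1) / (Ψ.dAB : K) = 0
    rw [Cert.A_upper_zero hV h.2 l.2 hlt', Z8.zero_def, Z8.eval_zero, zero_div]
  have hAd : ∀ l : Fin Ψ.r, Am l l ≠ 0 := fun l =>
    div_ne_zero (Z8.eval_ne_zero_of_posConst ζ (hpiv l.1 l.2).1) hdK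
  have hBt : Bm.BlockTriangular id := by
    intro l g hlt
    have hlt' : g < l := hlt
    show Z8.eval ζ (Ψ.Bz l.1 g.1) = 0
    rw [Cert.B_lower_zero hV l.2 g.2 hlt', Z8.zero_def, Z8.eval_zero]
  have hBd : ∀ l : Fin Ψ.r, Bm l l ≠ 0 := by
    intro l
    have hw := Z8.eval_ne_zero_of_posConst ζ (hpiv l.1 l.2).2
    rw [Z8.eval_mul ζ h4] at hw
    exact left_ne_zero_of_mul hw
  have hdet : IsUnit (N.submatrix ρf γf).det := by
    rw [hS, Matrix.det_mul, Matrix.det_of_lowerTriangular _ hAt, Matrix.det_of_upperTriangular hBt]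
    exact isUnit_iff_ne_zero.mpr (mul_ne_zero (Finset.prod_ne_zero_iff.mpr fun l _ => hAd l) (Finset.prod_ne_zero_iff.mpr fun l _ => hBd l))
  have hrank : (N.submatrix ρf γf).rank = Ψ.r := by
    rw [Matrix.rank_of_isUnit _ ((Matrix.isUnit_iff_isUnit_det _).mpr hdet), Fintype.card_fin]
  calc Ψ.r = (N.submatrix ρf γf).rank := hrank.symm
    _ ≤ N.rank := Matrix.rank_submatrix_le _ _ _

/-- MAIN THEOREM: a valid certificate decides rank N = r for every characteristic-0 field K, every ζ ∈ K with ζ⁴ = −1 and every matrix N whose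
entries are eval_ζ (f rows[a] cols[b]), provided the grading makes incompatible entries vanish. -/
theorem rank_eq_of_valid (h4 : ζ ^ 4 = -1) (hvan : ∀ rd cd, tyR rd + tyC cd ≠ tgt → f rd cd = 0)
    (hm : rows.length = m) (hn : cols.length = n) (hV : Ψ.valid f tyR tyC tgt rows cols m n = true)
    (N : Matrix (Fin m) (Fin n) K) (hN : ∀ a b, N a b = Z8.eval ζ (f (lget default rows a.1) (lget default cols b.1))) :
    N.rank = Ψ.r :=
  le_antisymm (rank_le_of_valid ζ h4 hvan hm hn hV N hN) (le_rank_of_valid ζ h4 hV N hN)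

end sound

end Summit.HodgeConjecture.HodgeConjecture.HodgeLocus.Census.Z8Cert
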